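import Summits.CriticalPhenomena.PercolationContinuityZ3.Theorems.PercNearOneGluingNoHeavyPcintTFibProcess
import Summits.CriticalPhenomena.PercolationContinuityZ3.Theorems.PercNearOneGluingNoHeavyPcintProductResampling
import Literature.Probability.Percolation.SitePercolationMeasure
import HarnessLib

/-!
# PCINT lane, T-fibre route, step (6b): the `𝕋 × K_m` side of the box inequality as a `P_p`-probability

Cell `prim-pcint`, seat `prim-pcint-1` (gen 11); memo `run/shared/lean/prim/pcint/T-FIBRE-ROUTE.md` §6.

Bridge between fibre-state assignments `w : Λ → (ZMod m → Bool)` with the product weight `pw (wt p)` and the tree's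
site percolation measure on `𝕋 × K_m` (analogue of `…PcintKingRouteBridgeStar.lean`): the fibre sites above `Λ`
(`fibSites`), the bijection `fibCfgEquiv` with `Prop`-configurations on them, the identification of weights
(`siteWeight_fibCfgEquiv`), the path event `fibPathEvent` (an open `𝕋 × K_m`-path through fibre sites above `Λ` from
`(o, 0)` to the fibre of a site of `B`), and

  `Σ_w pw(w) · 𝟙[∃ v ∈ B, ∃ j, PathIn (𝕋 × K_m) (cfgF w) (o,0) (v,j)] ≤ P_p(fibPathEvent Λ o B)`

(`TFib.sum_pw_path_le_real_pathEvent`; in fact an equality).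
-/

noncomputable section

namespace Summit.CriticalPhenomena.PercolationContinuityZ3.Theorems.Pcint

namespace TFib

open Finset AdaptDom Literature.Probability.Percolation Literature.Probability.LatticeModels

variable {m : ℕ} [NeZero m] (Λ : Finset (Site 2))

/-- The fibre sites above `Λ`. -/
def fibSites : Finset (Site 2 × ZMod m) := (Λ.attach ×ˢ (univ : Finset (ZMod m))).image fun z => (z.1.1, z.2)

/-- The fibre sites of `v ∈ Λ` belong to `fibSites Λ`. -/
theorem mk_mem_fibSites (v : ↥Λ) (i : ZMod m) : (v.1, i) ∈ fibSites (m := m) Λ :=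
  mem_image.2 ⟨(v, i), mem_product.2 ⟨mem_attach _ _, mem_univ _⟩, rfl⟩

/-- Every fibre site comes from a site of `Λ` and a layer. -/
theorem exists_eq_of_mem_fibSites {s : Site 2 × ZMod m} (hs : s ∈ fibSites (m := m) Λ) :
    ∃ v : ↥Λ, ∃ i : ZMod m, s = (v.1, i) := by
  obtain ⟨⟨v, i⟩, -, h⟩ := mem_image.1 hs
  exact ⟨v, i, h.symm⟩

/-- The open fibre sites of `w` are fibre sites. -/
theorem cfgF_subset_fibSites (w : ↥Λ → (ZMod m → Bool)) : cfgF m Λ w ⊆ ↑(fibSites (m := m) Λ) := by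
  rintro ⟨x, i⟩ ⟨v, hv, -⟩
  simp only at hv
  rw [hv]; exact mk_mem_fibSites Λ v i

/-- **The path event** on `𝕋 × K_m`-site configurations: an open path through fibre sites above `Λ` from `(o, 0)` to the
fibre of some `v ∈ B`. -/
def fibPathEvent (o : ↥Λ) (B : Finset ↥Λ) : Set (Set (Site 2 × ZMod m)) :=
  {ω | ∃ v ∈ B, ∃ j : ZMod m, PathIn (tfib m) (ω ∩ ↑(fibSites (m := m) Λ)) (o.1, 0) (v.1, j)}

/-- The path event is determined by the fibre sites. -/
theorem determinedBy_fibPathEvent (o : ↥Λ) (B : Finset ↥Λ) :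
    DeterminedBy (fibPathEvent (m := m) Λ o B) ↑(fibSites (m := m) Λ) := by
  rw [determinedBy_iff]
  intro ω ω' h
  simp only [fibPathEvent, Set.mem_setOf_eq, h]

/-- The `Prop`-configuration on the fibre sites of a fibre-state assignment. -/
def fibCfg (w : ↥Λ → (ZMod m → Bool)) : ↥(fibSites (m := m) Λ) → Prop := fun s => s.1 ∈ cfgF m Λ w

/-- The fibre-state assignment of a `Prop`-configuration on the fibre sites. -/
def fibOfCfg (y : ↥(fibSites (m := m) Λ) → Prop) : ↥Λ → (ZMod m → Bool) := fun v i =>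
  @decide (y ⟨(v.1, i), mk_mem_fibSites Λ v i⟩) (Classical.dec _)

/-- `fibCfg` at a fibre site. -/
theorem fibCfg_mk (w : ↥Λ → (ZMod m → Bool)) (v : ↥Λ) (i : ZMod m) :
    fibCfg Λ w ⟨(v.1, i), mk_mem_fibSites Λ v i⟩ ↔ w v i = true := mk_mem_cfgF_iff

/-- **Fibre states ≃ `Prop`-configurations on the fibre sites.** -/
def fibCfgEquiv : (↥Λ → (ZMod m → Bool)) ≃ (↥(fibSites (m := m) Λ) → Prop) where
  toFun := fibCfg Λ
  invFun := fibOfCfg Λ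
  left_inv w := by
    funext v i
    have h := fibCfg_mk Λ w v i
    unfold fibOfCfg
    show @decide _ (Classical.dec _) = w v i
    cases hb : w v i
    · rw [hb] at h; simp only [Bool.false_eq_true, iff_false] at h; simp [h]
    · rw [hb] at h; simp only [iff_true] at h; simp [h]
  right_inv y := by
    funext s
    obtain ⟨v, i, hs⟩ := exists_eq_of_mem_fibSites Λ s.2
    have hs' : s = ⟨(v.1, i), mk_mem_fibSites Λ v i⟩ := Subtype.ext hs
    subst hs'
    apply propext
    rw [fibCfg_mk]
    unfold fibOfCfg
    simp

variable {Λ}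

/-- The lift of `fibCfg w` to `𝕋 × K_m` is `cfgF w`. -/
theorem liftSiteConfig_fibCfg (w : ↥Λ → (ZMod m → Bool)) :
    {s | liftSiteConfig (fibSites (m := m) Λ) (fibCfg Λ w) s} = cfgF m Λ w := by
  ext s
  simp only [Set.mem_setOf_eq, liftSiteConfig, fibCfg]
  constructor
  · rintro ⟨-, h⟩; exact h
  · intro h; exact ⟨cfgF_subset_fibSites Λ w h, h⟩

/-- **The tree's product weight on the fibre sites is `pw (wt p)`.** -/
theorem siteWeight_fibCfgEquiv (p : unitInterval) (w : ↥Λ → (ZMod m → Bool)) :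
    siteWeight p (fibCfgEquiv Λ w) = pw (fun _ => wt (p : ℝ)) w := by
  classical
  unfold siteWeight pw wt
  let e : ↥Λ × ZMod m ≃ ↥(fibSites (m := m) Λ) :=
    Equiv.ofBijective (fun z => ⟨(z.1.1, z.2), mk_mem_fibSites Λ z.1 z.2⟩)
      ⟨fun z z' h => by
        have h' := congrArg Subtype.val h
        simp only [Prod.mk.injEq] at h'
        exact Prod.ext (Subtype.ext h'.1) h'.2,
       fun s => by
        obtain ⟨v, i, hs⟩ := exists_eq_of_mem_fibSites Λ s.2
        exact ⟨(v, i), Subtype.ext hs.symm⟩⟩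
  rw [← Fintype.prod_equiv e (fun z => (bernoulliProp p).real {fibCfgEquiv Λ w (e z)}) _ (fun z => rfl)]
  rw [Fintype.prod_prod_type]
  refine Finset.prod_congr rfl fun v _ => Finset.prod_congr rfl fun i _ => ?_
  change (bernoulliProp p).real {fibCfg Λ w ⟨(v.1, i), _⟩} = bern (p : ℝ) (w v i)
  have h := fibCfg_mk Λ w v i
  unfold bern
  cases hw : w v i
  · rw [hw] at h
    have : fibCfg Λ w ⟨(v.1, i), mk_mem_fibSites Λ v i⟩ = False := propext (by simpa using h)
    rw [this]; simp
  · rw [hw] at h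
    have : fibCfg Λ w ⟨(v.1, i), mk_mem_fibSites Λ v i⟩ = True := propext (by simpa using h)
    rw [this]; simp

open Classical in
/-- **The `𝕋 × K_m` side of the box inequality**: the `pw`-weight of the fibre-state assignments with an open path of
`cfgF w` from `(o, 0)` to the fibre of a site of `B` is at most `P_p(fibPathEvent Λ o B)`. -/
theorem sum_pw_path_le_real_pathEvent (p : unitInterval) (o : ↥Λ) (B : Finset ↥Λ) :
    ∑ w : ↥Λ → (ZMod m → Bool), pw (fun _ => wt (p : ℝ)) w *
        (if ∃ v ∈ B, ∃ j : ZMod m, PathIn (tfib m) (cfgF m Λ w) (o.1, 0) (v.1, j) then (1 : ℝ) else 0) ≤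
      (sitePercolation (Site 2 × ZMod m) p).real (fibPathEvent (m := m) Λ o B) := by
  rw [sitePercolation_real_eq_sum p (determinedBy_fibPathEvent Λ o B)]
  set E := fibPathEvent (m := m) Λ o B with hE
  have hwt : ∀ w : ↥Λ → (ZMod m → Bool), 0 ≤ pw (fun _ => wt (p : ℝ)) w := fun w =>
    pw_nonneg (fun _ x => wt_nonneg p.2.1 p.2.2 x) w
  have htrace : ∀ w : ↥Λ → (ZMod m → Bool),
      (∃ v ∈ B, ∃ j : ZMod m, PathIn (tfib m) (cfgF m Λ w) (o.1, 0) (v.1, j)) →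
        fibCfgEquiv Λ w ∈ traceEvent (fibSites (m := m) Λ) E := by
    rintro w ⟨v, hv, j, hp⟩
    change {s | liftSiteConfig (fibSites (m := m) Λ) (fibCfg Λ w) s} ∈ E
    rw [liftSiteConfig_fibCfg]
    exact ⟨v, hv, j, hp.mono fun s hs => ⟨hs, cfgF_subset_fibSites Λ w hs⟩⟩
  have step1 : ∑ w : ↥Λ → (ZMod m → Bool), pw (fun _ => wt (p : ℝ)) w *
        (if ∃ v ∈ B, ∃ j : ZMod m, PathIn (tfib m) (cfgF m Λ w) (o.1, 0) (v.1, j) then (1 : ℝ) else 0) ≤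
      ∑ w ∈ univ.filter (fun w : ↥Λ → (ZMod m → Bool) => fibCfgEquiv Λ w ∈ traceEvent (fibSites (m := m) Λ) E),
        pw (fun _ => wt (p : ℝ)) w := by
    rw [Finset.sum_filter]
    refine Finset.sum_le_sum fun w _ => ?_
    by_cases h : ∃ v ∈ B, ∃ j : ZMod m, PathIn (tfib m) (cfgF m Λ w) (o.1, 0) (v.1, j)
    · rw [if_pos h, if_pos (htrace w h), mul_one]
    · rw [if_neg h, mul_zero]; split_ifs
      · exact hwt w
      · exact le_rfl
  have step2 : ∑ w ∈ univ.filter (fun w : ↥Λ → (ZMod m → Bool) => fibCfgEquiv Λ w ∈ traceEvent (fibSites (m := m) Λ) E),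
        pw (fun _ => wt (p : ℝ)) w =
      ∑ y ∈ (univ.filter (fun w : ↥Λ → (ZMod m → Bool) => fibCfgEquiv Λ w ∈ traceEvent (fibSites (m := m) Λ) E)).map
        (fibCfgEquiv Λ).toEmbedding, siteWeight p y := by
    rw [Finset.sum_map]
    exact Finset.sum_congr rfl fun w _ => by rw [Equiv.coe_toEmbedding, siteWeight_fibCfgEquiv]
  refine step1.trans (step2.le.trans (Finset.sum_le_sum_of_subset_of_nonneg ?_ fun y _ _ => siteWeight_nonneg p y))
  intro y hy
  rw [Finset.mem_map] at hy
  obtain ⟨w, hw, rfl⟩ := hy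
  exact mem_filter.2 ⟨by simp, (mem_filter.1 hw).2⟩

end TFib

end Summit.CriticalPhenomena.PercolationContinuityZ3.Theorems.Pcint

end
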